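import Literature.NumberTheory.LFunctions.LiouvilleNonpretentious
import Literature.NumberTheory.LFunctions.TaoLogElliottProp24
import HarnessLib

/-!
# Log-averaged two-point Chowla for Liouville (parity.S21): assembly of the proof DAG

`Literature.NumberTheory.Sieve.tao_log_chowla_liouville` (Tao, Forum Math. Pi 4 (2016) e8, Theorem 1.2 / Cor. 1.5:
`∑_{n ≤ x} λ(a₁n+b₁) λ(a₂n+b₂)/n = o(log x)` for `a₁b₂ ≠ a₂b₁`) was reduced in
`LiouvilleNonpretentious.lean` to Tao's Theorem 2.3 (`Literature.NumberTheory.LFunctions.Tao2016_theorem23`) by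
`Literature.NumberTheory.LFunctions.tao_log_chowla_liouville_of_theorem23`, using the unconditional non-pretentiousness
of `λ` (`Literature.NumberTheory.LFunctions.Tao2016_liouvilleNonpretentious_holds`).  Theorem 2.3 in turn is, by
`TaoLogElliottProp24.lean` (`Literature.NumberTheory.LFunctions.Tao2016_theorem23_of_MRT_core`: Proposition 2.4 proved from
Matomäki–Radziwiłł–Tao 2015, Theorem 1.7), a consequence of the two remaining named facts
`Literature.NumberTheory.LFunctions.MatomakiRadziwillTao2015_theorem17` (MRT 2015, Thm 1.7) and `Literature.NumberTheory.LFunctions.Tao2016_theorem23_core`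
(Tao 2016, the proof of Theorem 2.3 after (2.10): Lemma 2.5, Prop. 2.6, §3).  Hence:

* `Literature.Parity.tao_log_chowla_liouville_of_MRT_core :
    MatomakiRadziwillTao2015_theorem17 → Tao2016_theorem23_core → Parity.tao_log_chowla_liouville`,

so the Liouville fact has exactly the same open leaves as the Möbius one
(`TaoLogChowlaMoebiusAssembly.lean`), and one fewer than the route
`Parity.tao_log_chowla_liouville_of_facts` through Theorem 1.3 (which also needs MRT (1.12)).

## References
* T. Tao, *The logarithmically averaged Chowla and Elliott conjectures for two-point
  correlations*, Forum Math. Pi 4 (2016), e8; arXiv:1509.05422: Theorem 1.2, Theorem 2.3,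
  Proposition 2.4, §2 (first paragraph: for `λ` one may move directly to Theorem 2.3).
-/

namespace Literature.NumberTheory.LFunctions

/-- **parity.S21 (Liouville) from MRT 2015, Thm 1.7 and the core of the proof of Tao's Thm 2.3.**
[cite: TaoFMP2016, Theorem 1.2 (via Theorem 2.3 and Proposition 2.4)] -/
theorem tao_log_chowla_liouville_of_MRT_core (hMRT : MatomakiRadziwillTao2015_theorem17)
    (hcore : Tao2016_theorem23_core) : Sieve.tao_log_chowla_liouville :=
  LFunctions.tao_log_chowla_liouville_of_theorem23 (Tao2016_theorem23_of_MRT_core hMRT hcore)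

end Literature.NumberTheory.LFunctions
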